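/-
Copyright (c) 2026 the pub-hodgecm-mathlib formalisation cell (harness21).  Prover seat hodgecm-mathlib-K2E1-p14 (g4), Track B ∕ K2-LIT, h413 = `stmt-HodgeConjecture-24833`,
R90-TF section S8 «ContSpec-n½», socket (E) `sock_S8_res_exhaustion_le_closure` (B ED. 7 :276) via ★ `res_exhaustion_le_closure_of_record`: the `hScP` row of the E1 Plancherel
estate's bill («the block lies in the fixed space of the block projector `Pr = π_K(χK) ∘ R_f(e)`») SPLIT into its finite-level half — PAID at the index of record — and its
archimedean (K-type) half, the ONE visible letter (S8 dealer R90-CS-plan (g3) S8-R189 «(2) hScP (S)»; census `K2/K2E1-p14/g4/CENSUS-E4-PlancherelEstate.K2E1-p14-g4.md` rows (1)(2)).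
-/
import Summits.HodgeConjecture.HodgeConjecture.Theorems.R90S8ResGBlockLeFixU3            -- ★ p862920 (K2E1-p14 (g3)): `resGBlock_finLevel_le_fix`, `integral_of_le_maximalLevelFin` (`Sc(ι_f Kf, 1) ≤ Fix(ι_f Kf)` for `Kf ≤ K₀`)
import Summits.HodgeConjecture.HodgeConjecture.Theorems.K2E1BlockProjectorFixesVectorsU    -- ★ (K2E2-p12): `integratedOperator_apply_eq_self_of_forall_apply_eq` (`R(e) x = x` for `K′`-fixed `x`; every group)
import HarnessLib

/-!
# S8 (E) road — `R90S8ResGBlockFixedByProjectorU3`: the `hScP` row `Sc ≤ Fix(Pr)` of the E1 Plancherel estate's bill at the block of record, SPLIT — the finite-level half PAID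
# (`R_f(e) x = x` on `Sc(ι_f Kf, 1; χ₁, χ₂)`), the archimedean K-type half the one visible letter

Track B ∕ K2-LIT, crux h413 = `stmt-HodgeConjecture-24833`, route of record `HCCMUnconditional`; cell `hodgecm-mathlib`, R90-TF programme, section S8 «ContSpec-n½», socket (E)
(B ED. 7 :276) through ★ `res_exhaustion_le_closure_of_record` ∕ ★ `hNblk_of_record` (K2E1-p14 (g4)), whose per-block bill carries `hScP : Sc ≤ Fix(Pr)` with the block projector
`Pr = π_K(χK) ∘L R_f(e)` of ★ (N_blk,₃) `resG_isotypic_le_orthogonal_lines` (`hPdef`).  THEOREMS ONLY (no `def`, no `instance`, no `notation`, no named-fact hypothesis, no `sorry`;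
default heartbeats); lane `--supports stmt-HodgeConjecture-24833 --as helper` (count-neutral).  CLOSES NO SOCKET.

THE MATHEMATICS ([BorelJacquet1979, §4.1, §4.6]; [MoeglinWaldspurger1995, II.1.5]; [DeitmarEchterhoff2014, Lemma 1.6.3]).  At the index of record `Kf` (open, `≤ K₀ = ι_f⁻¹(K_∞·GL₃(𝒪̂_L))`,
hence `Kf ⊆ GL₃(𝒪̂_L)` ★ `integral_of_le_maximalLevelFin`) the block `Sc = resGBlock L μ (ι_f Kf) 1 χ₁ χ₂` (`χ₂` automorphic) lies in `Fix(ι_f Kf)` (★ `resGBlock_finLevel_le_fix`: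
the wave packets `θ_{f,φ}`, `φ ∈ V(χ₁, χ₂; ι_f Kf, 1)`, are right-`ι_f(Kf)`-invariant).  For a level kernel `e ∈ C_c(G_f)` vanishing off `Kf` with `∫ e dν_f = 1` (★ `exists_levelIdempotent_of_record`
inhabits it), `R_f(e) x = ∫ e(u) R(ι_f u) x dν_f(u) = x` on `Fix(ι_f Kf)` (★ `integratedOperator_apply_eq_self_of_forall_apply_eq`).  Hence `Pr x = π_K(χK)(R_f(e) x) = π_K(χK) x`, and
`Sc′ ≤ Fix(Pr)` for a sub-block `Sc′ ≤ Sc` EXACTLY WHEN the archimedean K-type projector fixes `Sc′` — the visible letter `hKfix`.  CENSUS-E4 FLAG (S8-R189, booked): for the WHOLE block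
`Sc′ = Sc` (all `K_∞`-types) `hKfix` forces `π_K(χK) = id` on `Sc`, so the (N₃) payment runs PER `K_∞`-TYPE piece `Sc′` (1-dim types: `χK` a character, D5′ verbatim; `dim τ > 1`: the
χ_τ-idempotent edition, reserved `R90S8ResGIsotypicTauIdempotentModelU3`) — this file serves both, `χK ∈ C_c(K, ℂ)` being arbitrary here (no multiplicativity used).
* §1 **`integratedOperator_fin_apply_eq_self_of_mem_resGBlock`** — the FINITE-LEVEL HALF, PAID: `R_f(e) x = x` for `x ∈ Sc(ι_f Kf, 1; χ₁, χ₂)`.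
* §2 **`hScP_of_archFix`** — the `hScP` BYTES of ★ (N_blk,₃) ∕ ★ `hNblk_of_record` (`Sc′ ≤ LinearMap.eqLocus (Pr : L² →ₗ L²) LinearMap.id`, `Pr` in `hPdef`'s spelling) for every `Sc′ ≤ Sc`,
  modulo the ONE visible letter `hKfix : ∀ x ∈ Sc′, π_K(χK) x = x`.
HONEST LABEL: HC_CM is proved only modulo the 7 printed citations (2 remaining named inputs: hLiu418 = `stmt-HodgeConjecture-24832`, h413 = `stmt-HodgeConjecture-24833`) until
rung 0 closes; REL ≠ ★ ≠ BUILT; this file asserts no named fact, is conditional on its visible binder `hKfix`, and closes no socket; count-neutral.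

## References
* [BorelJacquet1979] A. Borel, H. Jacquet, *Automorphic forms and automorphic representations*, PSPM 33.1 (1979), §4.1, §4.6.
* [MoeglinWaldspurger1995] C. Mœglin, J.-L. Waldspurger, *Spectral Decomposition and Eisenstein Series* (1995), II.1.5.
* [DeitmarEchterhoff2014] A. Deitmar, S. Echterhoff, *Principles of Harmonic Analysis* (2nd ed., 2014), Lemma 1.6.3.
-/

set_option autoImplicit false
set_option linter.dupNamespace false  -- the mandated namespace `…HodgeConjecture.HodgeConjecture.R90.S8` (LEAD #1 L1) repeats the summit's segment

noncomputable section

open MeasureTheory Filter Topology CompactlySupported NumberField ContRepresentation Set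
open scoped InnerProductSpace ENNReal NNReal ComplexConjugate
open Literature.NumberTheory.Automorphic Literature.NumberTheory.Automorphic.UnitaryGroup Literature.NumberTheory.GaloisRepresentations AdelicGroupData
open Literature.NumberTheory.Automorphic.Arthur2013.Leaves.TECR
open Summit.HodgeConjecture.HodgeConjecture.Cruxes.H413.K2E1BlockProjectorFixesVectorsU (integratedOperator_apply_eq_self_of_forall_apply_eq)

namespace Summit.HodgeConjecture.HodgeConjecture.R90.S8

variable (L : Type) [Field L] [NumberField L] [IsCMField L]
  (μ : Measure (quasiSplit (↥(maximalRealSubfield L)) L (IsCMField.complexConj L) 3).automorphicQuotient) [(quasiSplit (↥(maximalRealSubfield L)) L (IsCMField.complexConj L) 3).IsAutomorphicMeasure μ]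
  [MeasurableSpace (finAdelic (↥(maximalRealSubfield L)) L (IsCMField.complexConj L) 3 ((StdForm.antidiagonal 3).over L))] [BorelSpace (finAdelic (↥(maximalRealSubfield L)) L (IsCMField.complexConj L) 3 ((StdForm.antidiagonal 3).over L))]
  (νf : Measure (finAdelic (↥(maximalRealSubfield L)) L (IsCMField.complexConj L) 3 ((StdForm.antidiagonal 3).over L))) [IsFiniteMeasureOnCompacts νf]

/-! ## §1 The finite-level half, PAID: `R_f(e) x = x` on the block of record -/

/-- **`R_f(e) x = x` ON THE BLOCK OF RECORD**: for `Kf` open `≤ K₀` (so `Kf ⊆ GL₃(𝒪̂_L)`, ★ `integral_of_le_maximalLevelFin`), `χ₂` automorphic, a level kernel `e` vanishing off `Kf` with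
`∫ e dν_f = 1`, and `x ∈ Sc = resGBlock L μ (ι_f Kf) 1 χ₁ χ₂`: `x ∈ Fix(ι_f Kf)` (★ `resGBlock_finLevel_le_fix`) and `R_f(e) x = x` (★ `integratedOperator_apply_eq_self_of_forall_apply_eq`).
The Borel σ-algebra on `U(J₃)(𝔸)` is supplied locally. [cite: BorelJacquet1979, §4.1, §4.6] [cite: MoeglinWaldspurger1995, II.1.5] [cite: DeitmarEchterhoff2014, Lemma 1.6.3] -/
theorem integratedOperator_fin_apply_eq_self_of_mem_resGBlock (Kf : {Kf : Subgroup ↥(finAdelic (↥(maximalRealSubfield L)) L (IsCMField.complexConj L) 3 ((StdForm.antidiagonal 3).over L)) // IsOpen ((Kf : Subgroup ↥(finAdelic (↥(maximalRealSubfield L)) L (IsCMField.complexConj L) 3 ((StdForm.antidiagonal 3).over L))) : Set ↥(finAdelic (↥(maximalRealSubfield L)) L (IsCMField.complexConj L) 3 ((StdForm.antidiagonal 3).over L))) ∧ Kf ≤ ((((standardMaximalCompactGL 3 L).comap (adelicVal (↥(maximalRealSubfield L)) L (IsCMField.complexConj L) 3 ((StdForm.antidiagonal 3).over L)) : Subgroup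 (quasiSplit (↥(maximalRealSubfield L)) L (IsCMField.complexConj L) 3).Adelic)).comap (finAdelicToAdelic (↥(maximalRealSubfield L)) L (IsCMField.complexConj L) 3 ((StdForm.antidiagonal 3).over L)) : Subgroup ↥(finAdelic (↥(maximalRealSubfield L)) L (IsCMField.complexConj L) 3 ((StdForm.antidiagonal 3).over L)))})
    (e : C_c(finAdelic (↥(maximalRealSubfield L)) L (IsCMField.complexConj L) 3 ((StdForm.antidiagonal 3).over L), ℂ)) (he0 : ∀ x : finAdelic (↥(maximalRealSubfield L)) L (IsCMField.complexConj L) 3 ((StdForm.antidiagonal 3).over L), x ∉ Kf.1 → e x = 0) (he1 : ∫ x, e x ∂νf = 1)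
    (χ₁ : HeckeCharacter L) {χ₂ : ↥(TorusDict.torus (IsCMField.complexConj L)) →ₜ* ℂˣ} (hχ₂ : TorusDict.IsAutomorphic (IsCMField.complexConj L) χ₂)
    {x : (quasiSplit (↥(maximalRealSubfield L)) L (IsCMField.complexConj L) 3).L2 μ} (hx : x ∈ resGBlock L μ (Kf.1.map (finAdelicToAdelic (↥(maximalRealSubfield L)) L (IsCMField.complexConj L) 3 ((StdForm.antidiagonal 3).over L))) 1 χ₁ χ₂) :
    (((quasiSplit (↥(maximalRealSubfield L)) L (IsCMField.complexConj L) 3).rightRegular μ).restrict (finAdelicToAdelic (↥(maximalRealSubfield L)) L (IsCMField.complexConj L) 3 ((StdForm.antidiagonal 3).over L))).integratedOperator (((quasiSplit (↥(maximalRealSubfield L)) L (IsCMField.complexConj L) 3).isUnitary_rightRegular μ).restrict _) (((quasiSplit (↥(maximalRealSubfield L)) L (IsCMField.complexConj L) 3).isStronglyContinuous_rightRegular_holds μ).restrict _ (continuous_finAdelicToAdelic (↥(maximalRealSubfield L)) L (IsCMField.complexConj L) 3 ((StdForm.antidiagonal 3).over L))) νf e x = x := by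
  letI : MeasurableSpace (quasiSplit (↥(maximalRealSubfield L)) L (IsCMField.complexConj L) 3).Adelic := borel _
  haveI : BorelSpace (quasiSplit (↥(maximalRealSubfield L)) L (IsCMField.complexConj L) 3).Adelic := ⟨rfl⟩
  have hfix := resGBlock_finLevel_le_fix L μ Kf.1 (integral_of_le_maximalLevelFin L Kf.2.2) χ₁ hχ₂ hx
  refine integratedOperator_apply_eq_self_of_forall_apply_eq _ _ _ νf Kf.1 e he0 he1 x fun k hk => ?_
  have hk' := (Submodule.mem_iInf _).1 hfix ⟨k, hk⟩
  rw [Module.End.mem_eigenspace_iff, one_smul, ContinuousLinearMap.coe_coe] at hk'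
  rw [ContRepresentation.restrict_apply]
  exact hk'

/-! ## §2 The `hScP` bytes modulo the archimedean K-type half `hKfix` -/

/-- **`hScP` OF ★ (N_blk,₃) ∕ ★ `hNblk_of_record` FROM THE K-TYPE HALF ALONE**: with the block projector in `hPdef`'s spelling `Pr = π_K(χK) ∘L R_f(e)` (`K` compact with `κ : K →* G_∞`, Haar-type
`μK`, ANY kernel `χK ∈ C_c(K, ℂ)` — no multiplicativity used; `e` a level kernel at `Kf` as in §1), every sub-block `Sc′ ≤ Sc(ι_f Kf, 1; χ₁, χ₂)` on which the archimedean projector acts as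
the identity (`hKfix`, the ONE visible letter: «`Sc′` is `χK`-isotypic», e.g. a `K_∞`-type piece) satisfies `Sc′ ≤ Fix(Pr)` — the `hScP` binder bytes `Sc′ ≤ LinearMap.eqLocus (Pr : L² →ₗ L²) id`.
[cite: BorelJacquet1979, §4.1, §4.6] [cite: MoeglinWaldspurger1995, II.1.5] -/
theorem hScP_of_archFix (Kf : {Kf : Subgroup ↥(finAdelic (↥(maximalRealSubfield L)) L (IsCMField.complexConj L) 3 ((StdForm.antidiagonal 3).over L)) // IsOpen ((Kf : Subgroup ↥(finAdelic (↥(maximalRealSubfield L)) L (IsCMField.complexConj L) 3 ((StdForm.antidiagonal 3).over L))) : Set ↥(finAdelic (↥(maximalRealSubfield L)) L (IsCMField.complexConj L) 3 ((StdForm.antidiagonal 3).over L))) ∧ Kf ≤ ((((standardMaximalCompactGL 3 L).comap (adelicVal (↥(maximalRealSubfield L)) L (IsCMField.complexConj L) 3 ((StdForm.antidiagonal 3).over L)) : Subgroup (quasiSplit (↥(maximalRealSubfield L)) L (IsCMField.complexConj L) 3).Adelic)).comap (finAdelicToAdelic (↥(maximalRealSubfield L)) L (IsCMField.complexConj L)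 3 ((StdForm.antidiagonal 3).over L)) : Subgroup ↥(finAdelic (↥(maximalRealSubfield L)) L (IsCMField.complexConj L) 3 ((StdForm.antidiagonal 3).over L)))})
    (e : C_c(finAdelic (↥(maximalRealSubfield L)) L (IsCMField.complexConj L) 3 ((StdForm.antidiagonal 3).over L), ℂ)) (he0 : ∀ x : finAdelic (↥(maximalRealSubfield L)) L (IsCMField.complexConj L) 3 ((StdForm.antidiagonal 3).over L), x ∉ Kf.1 → e x = 0) (he1 : ∫ x, e x ∂νf = 1)
    (χ₁ : HeckeCharacter L) {χ₂ : ↥(TorusDict.torus (IsCMField.complexConj L)) →ₜ* ℂˣ} (hχ₂ : TorusDict.IsAutomorphic (IsCMField.complexConj L) χ₂)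
    {K : Type*} [Group K] [TopologicalSpace K] [MeasurableSpace K] [BorelSpace K]
    (κ : K →* UnitaryGroup.arch (↥(maximalRealSubfield L)) L (IsCMField.complexConj L) 3 ((StdForm.antidiagonal 3).over L)) (hκ : Continuous κ) (μK : Measure K) [IsFiniteMeasureOnCompacts μK] (χK : C_c(K, ℂ))
    (Sc' : Submodule ℂ ((quasiSplit (↥(maximalRealSubfield L)) L (IsCMField.complexConj L) 3).L2 μ)) (hSc' : Sc' ≤ resGBlock L μ (Kf.1.map (finAdelicToAdelic (↥(maximalRealSubfield L)) L (IsCMField.complexConj L) 3 ((StdForm.antidiagonal 3).over L))) 1 χ₁ χ₂)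
    (hKfix : ∀ x ∈ Sc', (((quasiSplit (↥(maximalRealSubfield L)) L (IsCMField.complexConj L) 3).rightRegular μ).restrict ((archToAdelic (↥(maximalRealSubfield L)) L (IsCMField.complexConj L) 3 ((StdForm.antidiagonal 3).over L)).comp κ)).integratedOperator (((quasiSplit (↥(maximalRealSubfield L)) L (IsCMField.complexConj L) 3).isUnitary_rightRegular μ).restrict _)
          (((quasiSplit (↥(maximalRealSubfield L)) L (IsCMField.complexConj L) 3).isStronglyContinuous_rightRegular_holds μ).restrict _ ((continuous_archToAdelic (↥(maximalRealSubfield L)) L (IsCMField.complexConj L) 3 ((StdForm.antidiagonal 3).over L)).comp hκ)) μK χK x = x) :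
    Sc' ≤ LinearMap.eqLocus ((((((quasiSplit (↥(maximalRealSubfield L)) L (IsCMField.complexConj L) 3).rightRegular μ).restrict ((archToAdelic (↥(maximalRealSubfield L)) L (IsCMField.complexConj L) 3 ((StdForm.antidiagonal 3).over L)).comp κ)).integratedOperator (((quasiSplit (↥(maximalRealSubfield L)) L (IsCMField.complexConj L) 3).isUnitary_rightRegular μ).restrict _)
          (((quasiSplit (↥(maximalRealSubfield L)) L (IsCMField.complexConj L) 3).isStronglyContinuous_rightRegular_holds μ).restrict _ ((continuous_archToAdelic (↥(maximalRealSubfield L)) L (IsCMField.complexConj L) 3 ((StdForm.antidiagonal 3).over L)).comp hκ)) μK χK ∘L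
        (((quasiSplit (↥(maximalRealSubfield L)) L (IsCMField.complexConj L) 3).rightRegular μ).restrict (finAdelicToAdelic (↥(maximalRealSubfield L)) L (IsCMField.complexConj L) 3 ((StdForm.antidiagonal 3).over L))).integratedOperator (((quasiSplit (↥(maximalRealSubfield L)) L (IsCMField.complexConj L) 3).isUnitary_rightRegular μ).restrict _) (((quasiSplit (↥(maximalRealSubfield L)) L (IsCMField.complexConj L) 3).isStronglyContinuous_rightRegular_holds μ).restrict _ (continuous_finAdelicToAdelic (↥(maximalRealSubfield L)) L (IsCMField.complexConj L) 3 ((StdForm.antidiagonal 3).over L))) νf e) : (quasiSplit (↥(maximalRealSubfield L)) L (IsCMField.complexConj L) 3).L2 μ →L[ℂ] (quasiSplit (↥(maximalRealSubfield L)) L (IsCMField.complexConj L) 3).L2 μ) : (quasiSplit (↥(maximalRealSubfield L)) L (IsCMField.complexConj L) 3).L2 μ →ₗ[ℂ] (quasiSplit (↥(maximalRealSubfield L)) L (IsCMField.complexConj L) 3).L2 μ) LinearMap.id := by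
  intro x hx
  rw [LinearMap.mem_eqLocus, LinearMap.id_apply, ContinuousLinearMap.coe_coe, ContinuousLinearMap.comp_apply,
    integratedOperator_fin_apply_eq_self_of_mem_resGBlock L μ νf Kf e he0 he1 χ₁ hχ₂ (hSc' hx)]
  exact hKfix x hx

end Summit.HodgeConjecture.HodgeConjecture.R90.S8

end
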